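import Literature.Geometry.Lorentzian.CoordCurvatureContinuity
import Literature.Geometry.Lorentzian.CoordScalarJet
import Literature.Geometry.Lorentzian.KerrConvergence
import HarnessLib

/-!
# Crux `ClusterCompleteness.OmegaLimitMultiKerr` (stmt-FinalStateConjecture-14664), line `Sketch` —
# the vacuum equations are closed under `C²` convergence in the `supCkENorm` vocabulary

Structure lemma (line lead gen 3, stub `ricAt_eq_zero_of_tendsto_supCkENorm`) for the LaSalle /
ω-limit reading of the recur-disjunct of the crux: the late-time `Cᵏ_loc` ω-limits
`G = lim (chart metric ∘ shift_{Tₙ})` of the chart metrics of a tame late chart of a VACUUM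
development (`exists_omegaLimit_translate_of_bounded_truncLateRegion`, `k ≥ 2`) arrive in the
currency `supCkENorm K k (Gₙ − G) → 0` on compact sets `K` of the chart domain; the first step in
IDENTIFYING them is that they are again vacuum. The tree proves the pointwise jet statement
`MetricCoord.ricAt_eq_zero_of_tendsto` (Ricci-flatness of coordinate metric components passes to
limits whose `2`-jets converge at the point); this file restates it in the `supCkENorm` currency so
that the two compose without further analysis:

* `tendsto_iteratedFDeriv_of_tendsto_supCkENorm(_sub)`, `tendsto_of_tendsto_supCkENorm_sub`,
  `tendsto_fderiv_of_tendsto_supCkENorm_sub`, `tendsto_fderiv_fderiv_of_tendsto_supCkENorm_sub` —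
  unpacking `supCkENorm K k (fᵢ − g) → 0` (any filter) into convergence at every `x ∈ K` of the
  values, the Fréchet derivatives and the second Fréchet derivatives (orders `0, 1, 2 ≤ k`);
* `ricAt_eq_zero_of_tendsto_supCkENorm` (registered stub, closed form) — **`supCkENorm`-`C²` limits
  of Ricci-flat metric components are Ricci-flat**: if `Gᵢ → G` in the sense
  `supCkENorm K k (Gᵢ − G) → 0` (`k ≥ 2`) along a nontrivial filter, `K ⊆ V`, the `Gᵢ` are
  (eventually) metric components on the open set `V` with `Ric[Gᵢ] = 0` eventually at each point
  of `K`, and the limit `G` is a field of metric components on `V`, then `Ric[G] = 0` on `K`;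
* `ricAt_eq_zero_of_tendsto_supCkENorm_translate` — the same for limits of TRANSLATES
  `y ↦ H (y + vᵢ)` of one Ricci-flat field `H` (the shape produced by the ω-limit theorems, with
  `vᵢ = Tᵢ • e`), via the naturality `Ric[H ∘ (· + a)](x) = Ric[H](x + a)`
  (`MetricCoord.ricAt_comp_add_right`) and `isMetricOn_comp_add_right`.

Scope. The limit is ASSUMED to be a field of metric components (`MetricCoord.IsMetricOn G V`:
smooth, symmetric, invertible on `V`), as the tree's jet calculus requires; for ω-limits of chart
metrics invertibility comes from the anchor and smoothness is a separate matter (a `Cᵏ` ω-limit is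
not upgraded here). Everything is proved; Mathlib + `Literature` only.

## References
* P. Petersen, *Riemannian Geometry*, 2nd ed., GTM 171, Springer 2006, Ch. 10, §3.2 (curvature
  under `C²` convergence of metrics). [Petersen2006]
* B. O'Neill, *Semi-Riemannian geometry*, Academic Press 1983, Ch. 3, Lemma 3.52. [ONeill1983]
-/

-- every `Summit.FinalStateConjecture.FinalStateConjecture.…` name repeats the summit = sub-problem segment (D-0017 layout)
set_option linter.dupNamespace false

noncomputable section

open scoped Manifold ContDiff Topology ENNReal
open Set Filter TopologicalSpace

namespace Summit.FinalStateConjecture.FinalStateConjecture.Theorems.ClusterCompleteness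

open Literature.Geometry.Lorentzian

/-! ### Unpacking `supCkENorm`-convergence into convergence of jets at a point -/

section Unpack

variable {ι : Type*} {l : Filter ι} {F W : Type*} [NormedAddCommGroup F] [NormedSpace ℝ F]
  [NormedAddCommGroup W] [NormedSpace ℝ W]

/-- If the `Cᵏ` sup norms of `φᵢ` over `K` tend to `0` along a filter, then every derivative of
order `m ≤ k` of `φᵢ` at every point of `K` tends to `0` (the sup norm dominates the pointwise
derivative, `enorm_iteratedFDeriv_le_supCkENorm`). [folklore] -/
theorem tendsto_iteratedFDeriv_of_tendsto_supCkENorm {φ : ι → F → W} {K : Set F} {k m : ℕ}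
    (hm : m ≤ k) {x : F} (hx : x ∈ K) (h : Tendsto (fun i ↦ supCkENorm K k (φ i)) l (𝓝 0)) :
    Tendsto (fun i ↦ iteratedFDeriv ℝ m (φ i) x) l (𝓝 0) :=
  tendsto_zero_iff_enorm_tendsto_zero.2
    (tendsto_of_tendsto_of_tendsto_of_le_of_le tendsto_const_nhds h (fun _ ↦ zero_le)
      fun i ↦ enorm_iteratedFDeriv_le_supCkENorm hm hx (φ i))

/-- Difference form: if `supCkENorm K k (fᵢ − g) → 0` and `fᵢ` (eventually), `g` are `Cᵐ` at the
point `x ∈ K`, `m ≤ k`, then `Dᵐfᵢ(x) → Dᵐg(x)`. [folklore] -/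
theorem tendsto_iteratedFDeriv_of_tendsto_supCkENorm_sub {f : ι → F → W} {g : F → W} {K : Set F}
    {k m : ℕ} (hm : m ≤ k) {x : F} (hx : x ∈ K) (hf : ∀ᶠ i in l, ContDiffAt ℝ m (f i) x)
    (hg : ContDiffAt ℝ m g x)
    (h : Tendsto (fun i ↦ supCkENorm K k (fun y ↦ f i y - g y)) l (𝓝 0)) :
    Tendsto (fun i ↦ iteratedFDeriv ℝ m (f i) x) l (𝓝 (iteratedFDeriv ℝ m g x)) := by
  rw [← tendsto_sub_nhds_zero_iff]
  refine (tendsto_iteratedFDeriv_of_tendsto_supCkENorm hm hx h).congr' (hf.mono fun i hi ↦ ?_)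
  exact iteratedFDeriv_sub_apply hi hg

/-- Order `0`: if `supCkENorm K k (fᵢ − g) → 0` then `fᵢ(x) → g(x)` at every `x ∈ K`
(`‖D⁰φ(x)‖ = ‖φ(x)‖`). [folklore] -/
theorem tendsto_of_tendsto_supCkENorm_sub {f : ι → F → W} {g : F → W} {K : Set F} {k : ℕ}
    {x : F} (hx : x ∈ K) (h : Tendsto (fun i ↦ supCkENorm K k (fun y ↦ f i y - g y)) l (𝓝 0)) :
    Tendsto (fun i ↦ f i x) l (𝓝 (g x)) := by
  rw [← tendsto_sub_nhds_zero_iff, tendsto_zero_iff_norm_tendsto_zero]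
  refine (tendsto_zero_iff_norm_tendsto_zero.1
    (tendsto_iteratedFDeriv_of_tendsto_supCkENorm (Nat.zero_le k) hx h)).congr fun i ↦ ?_
  exact norm_iteratedFDeriv_zero

/-- Currying (`E [×1]→L F ≃ E →L F`): convergence of `D¹uᵢ(x)` gives convergence of the Fréchet
derivatives `Duᵢ(x)`, along any filter. [folklore] -/
private theorem tendsto_fderiv_of_tendsto_iteratedFDeriv_one {u : ι → F → W} {u₀ : F → W} {x : F}
    (h : Tendsto (fun i ↦ iteratedFDeriv ℝ 1 (u i) x) l (𝓝 (iteratedFDeriv ℝ 1 u₀ x))) :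
    Tendsto (fun i ↦ fderiv ℝ (u i) x) l (𝓝 (fderiv ℝ u₀ x)) := by
  -- adapted from `Literature.Analysis.FunctionSpaces.CkArzelaAscoli` (sequences): any filter
  have h1 := ((continuousMultilinearCurryFin1 ℝ F W).continuous.tendsto _).comp h
  have hcurry : ∀ u : F → W,
      continuousMultilinearCurryFin1 ℝ F W (iteratedFDeriv ℝ 1 u x) = fderiv ℝ u x := fun u ↦ by
    ext v
    rw [continuousMultilinearCurryFin1_apply, iteratedFDeriv_one_apply]
    rfl
  simpa only [Function.comp_def, hcurry] using h1

/-- Currying (`iteratedFDeriv_succ_eq_comp_right`): convergence of `D²uᵢ(x)` gives convergence of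
`D¹(Duᵢ)(x)`, along any filter. [folklore] -/
private theorem tendsto_iteratedFDeriv_one_fderiv_of_two {u : ι → F → W} {u₀ : F → W} {x : F}
    (h : Tendsto (fun i ↦ iteratedFDeriv ℝ 2 (u i) x) l (𝓝 (iteratedFDeriv ℝ 2 u₀ x))) :
    Tendsto (fun i ↦ iteratedFDeriv ℝ 1 (fderiv ℝ (u i)) x) l
      (𝓝 (iteratedFDeriv ℝ 1 (fderiv ℝ u₀) x)) := by
  -- adapted from `Literature.Analysis.FunctionSpaces.CkArzelaAscoli` (sequences): any filter
  have hR : ∀ u : F → W, iteratedFDeriv ℝ 1 (fderiv ℝ u) x =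
      continuousMultilinearCurryRightEquiv' ℝ 1 F W (iteratedFDeriv ℝ 2 u x) := fun u ↦ by
    rw [iteratedFDeriv_succ_eq_comp_right (n := 1), Function.comp_apply,
      LinearIsometryEquiv.apply_symm_apply]
  simp only [hR]
  exact ((continuousMultilinearCurryRightEquiv' ℝ 1 F W).continuous.tendsto _).comp h

/-- Order `1`: if `supCkENorm K k (fᵢ − g) → 0`, `1 ≤ k`, and `fᵢ` (eventually), `g` are `Cᵏ` at
`x ∈ K`, then `Dfᵢ(x) → Dg(x)`. [folklore] -/
theorem tendsto_fderiv_of_tendsto_supCkENorm_sub {f : ι → F → W} {g : F → W} {K : Set F} {k : ℕ}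
    (hk : 1 ≤ k) {x : F} (hx : x ∈ K) (hf : ∀ᶠ i in l, ContDiffAt ℝ k (f i) x)
    (hg : ContDiffAt ℝ k g x)
    (h : Tendsto (fun i ↦ supCkENorm K k (fun y ↦ f i y - g y)) l (𝓝 0)) :
    Tendsto (fun i ↦ fderiv ℝ (f i) x) l (𝓝 (fderiv ℝ g x)) :=
  tendsto_fderiv_of_tendsto_iteratedFDeriv_one
    (tendsto_iteratedFDeriv_of_tendsto_supCkENorm_sub hk hx
      (hf.mono fun _ hi ↦ hi.of_le (by exact_mod_cast hk)) (hg.of_le (by exact_mod_cast hk)) h)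

/-- Order `2`: if `supCkENorm K k (fᵢ − g) → 0`, `2 ≤ k`, and `fᵢ` (eventually), `g` are `Cᵏ` at
`x ∈ K`, then `D(Dfᵢ)(x) → D(Dg)(x)`. [folklore] -/
theorem tendsto_fderiv_fderiv_of_tendsto_supCkENorm_sub {f : ι → F → W} {g : F → W} {K : Set F}
    {k : ℕ} (hk : 2 ≤ k) {x : F} (hx : x ∈ K) (hf : ∀ᶠ i in l, ContDiffAt ℝ k (f i) x)
    (hg : ContDiffAt ℝ k g x)
    (h : Tendsto (fun i ↦ supCkENorm K k (fun y ↦ f i y - g y)) l (𝓝 0)) :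
    Tendsto (fun i ↦ fderiv ℝ (fderiv ℝ (f i)) x) l (𝓝 (fderiv ℝ (fderiv ℝ g) x)) :=
  tendsto_fderiv_of_tendsto_iteratedFDeriv_one (tendsto_iteratedFDeriv_one_fderiv_of_two
    (tendsto_iteratedFDeriv_of_tendsto_supCkENorm_sub hk hx
      (hf.mono fun _ hi ↦ hi.of_le (by exact_mod_cast hk)) (hg.of_le (by exact_mod_cast hk)) h))

end Unpack

/-! ### Ricci-flatness passes to `supCkENorm`-`C²` limits -/

/-- **The vacuum equations are closed under `C²` convergence in the `supCkENorm` vocabulary**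
(registered stub `ricAt_eq_zero_of_tendsto_supCkENorm` of the crux item, closed form). Let `E` be
a finite-dimensional real normed space, `l` a nontrivial filter, `K ⊆ V ⊆ E`. If the `Gᵢ` are
eventually metric components on the open set `V` (`MetricCoord.IsMetricOn`), the limit `G` is a
field of metric components on `V`, `supCkENorm K k (Gᵢ − G) → 0` along `l` for some `k ≥ 2`, and
at each point of `K` eventually `Ric[Gᵢ] = 0`, then `Ric[G] = 0` on `K`: the `2`-jets converge at
every point of `K`
(`tendsto_of/ tendsto_fderiv_of/ tendsto_fderiv_fderiv_of_tendsto_supCkENorm_sub`) and the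
coordinate Ricci form is continuous in the `2`-jet (`MetricCoord.ricAt_eq_zero_of_tendsto`).
[cite: Petersen2006, Ch. 10 §3.2] -/
theorem ricAt_eq_zero_of_tendsto_supCkENorm : ∀ {E : Type*} [NormedAddCommGroup E] [NormedSpace ℝ E] [FiniteDimensional ℝ E] {ι : Type*} {l : Filter ι} [l.NeBot] {V K : Set E} {Gs : ι → E → E →L[ℝ] E →L[ℝ] ℝ} {G : E → E →L[ℝ] E →L[ℝ] ℝ} {k : ℕ}, 2 ≤ k → (∀ᶠ i in l, MetricCoord.IsMetricOn (Gs i) V) → MetricCoord.IsMetricOn G V → K ⊆ V → Tendsto (fun i ↦ supCkENorm K k (fun y ↦ Gs i y - G y)) l (𝓝 0) → (∀ x ∈ K, ∀ᶠ i in l, MetricCoord.ricAt (Gs i) x = 0) → ∀ x ∈ K, MetricCoord.ricAt G x = 0 := by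
  intro E _ _ _ ι l _ V K Gs G k hk hGs hG hKV hlim hric x hx
  classical
  haveI : CompleteSpace E := FiniteDimensional.complete ℝ E
  have hxV : x ∈ V := hKV hx
  have hVx : V ∈ 𝓝 x := hG.isOpen.mem_nhds hxV
  -- replace the (finitely many, filter-wise) `Gs i` that are not metric components on `V` by `G`
  set Gs' : ι → E → E →L[ℝ] E →L[ℝ] ℝ := fun i ↦ if MetricCoord.IsMetricOn (Gs i) V then Gs i else G
    with hGs'def
  have hGs' : ∀ i, MetricCoord.IsMetricOn (Gs' i) V := fun i ↦ by
    by_cases h : MetricCoord.IsMetricOn (Gs i) V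
    · simp only [hGs'def, h, if_true]
    · simp only [hGs'def, h, if_false]; exact hG
  have heq : ∀ᶠ i in l, Gs' i = Gs i := hGs.mono fun i hi ↦ if_pos hi
  have hlim' : Tendsto (fun i ↦ supCkENorm K k (fun y ↦ Gs' i y - G y)) l (𝓝 0) :=
    hlim.congr' (heq.mono fun i hi ↦ by simp only [hi])
  have hric' : ∀ᶠ i in l, MetricCoord.ricAt (Gs' i) x = 0 :=
    (heq.and (hric x hx)).mono fun i hi ↦ by rw [hi.1]; exact hi.2
  -- the `2`-jets converge at `x`
  have hGsk : ∀ᶠ i in l, ContDiffAt ℝ k (Gs' i) x := Eventually.of_forall fun i ↦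
    ((hGs' i).contDiffOn.contDiffAt hVx).of_le (by norm_cast; exact le_top)
  have hGk : ContDiffAt ℝ k G x := (hG.contDiffOn.contDiffAt hVx).of_le (by norm_cast; exact le_top)
  exact MetricCoord.ricAt_eq_zero_of_tendsto hGs' hG hxV
    (tendsto_of_tendsto_supCkENorm_sub hx hlim')
    (tendsto_fderiv_of_tendsto_supCkENorm_sub (one_le_two.trans hk) hx hGsk hGk hlim')
    (tendsto_fderiv_fderiv_of_tendsto_supCkENorm_sub hk hx hGsk hGk hlim') hric'

/-! ### Limits of translates of one Ricci-flat field -/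

/-- Translated metric components are metric components: if `H` is a field of metric components on
`O` and the translate `V + a` of the open set `V` lies in `O`, then `y ↦ H (y + a)` is a field of
metric components on `V`. [folklore] -/
theorem isMetricOn_comp_add_right {E : Type*} [NormedAddCommGroup E] [NormedSpace ℝ E]
    {H : E → E →L[ℝ] E →L[ℝ] ℝ} {O V : Set E} (hH : MetricCoord.IsMetricOn H O) (hV : IsOpen V)
    {a : E} (hVO : ∀ y ∈ V, y + a ∈ O) : MetricCoord.IsMetricOn (fun y ↦ H (y + a)) V where
  isOpen := hV
  contDiffOn := hH.contDiffOn.comp (contDiff_id.add contDiff_const).contDiffOn hVO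
  symm y hy v w := hH.symm _ (hVO y hy) v w
  isInvertible y hy := hH.isInvertible _ (hVO y hy)

/-- **ω-limits of translates of a vacuum metric are vacuum.** Let `H` be a field of metric
components on `O` with `Ric[H] = 0` on `O`, and let `vᵢ` be translation vectors such that
eventually the translate `V + vᵢ` of the open set `V` lies in `O` (for the ω-limit theorems:
`vᵢ = Tᵢ • e` with `Tᵢ → ∞`, `O` a late region invariant under the time translation `e`). If the
translates `y ↦ H (y + vᵢ)` converge to a field of metric components `G` on `V` in the sense
`supCkENorm K k (H (· + vᵢ) − G) → 0`, `k ≥ 2`, `K ⊆ V`, then `Ric[G] = 0` on `K`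
(`ricAt_eq_zero_of_tendsto_supCkENorm` with `MetricCoord.ricAt_comp_add_right`).
[cite: Petersen2006, Ch. 10 §3.2] -/
theorem ricAt_eq_zero_of_tendsto_supCkENorm_translate :
    ∀ {E : Type*} [NormedAddCommGroup E] [NormedSpace ℝ E] [FiniteDimensional ℝ E]
      {ι : Type*} {l : Filter ι} [l.NeBot] {O V K : Set E} {H G : E → E →L[ℝ] E →L[ℝ] ℝ}
      {v : ι → E} {k : ℕ}, 2 ≤ k → MetricCoord.IsMetricOn H O →
      (∀ y ∈ O, MetricCoord.ricAt H y = 0) → (∀ᶠ i in l, ∀ y ∈ V, y + v i ∈ O) →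
      MetricCoord.IsMetricOn G V → K ⊆ V →
      Tendsto (fun i ↦ supCkENorm K k (fun y ↦ H (y + v i) - G y)) l (𝓝 0) →
      ∀ x ∈ K, MetricCoord.ricAt G x = 0 := by
  intro E _ _ _ ι l _ O V K H G v k hk hH hricH hVO hG hKV hlim x hx
  refine ricAt_eq_zero_of_tendsto_supCkENorm (Gs := fun i y ↦ H (y + v i)) hk
    (hVO.mono fun i hi ↦ isMetricOn_comp_add_right hH hG.isOpen hi) hG hKV hlim (fun y hy ↦ ?_) x hx
  exact hVO.mono fun i hi ↦
    (MetricCoord.ricAt_comp_add_right H (v i) y).trans (hricH _ (hi y (hKV hy)))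

end Summit.FinalStateConjecture.FinalStateConjecture.Theorems.ClusterCompleteness

end
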